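import Mathlib.Analysis.Calculus.MeanValue
import Mathlib.Analysis.Calculus.ContDiff.Bounds
import Mathlib.Analysis.Normed.Module.FiniteDimension
import HarnessLib

/-!
# Landau's interpolation inequality and the convergence of derivatives

Analysis/Calculus support file (everything proved, theorems only). The elementary device by which
*uniform bounds on all derivatives upgrade convergence of functions to convergence of all their
derivatives* (Landau 1913 / Kolmogorov; Dieudonné, *Foundations of Modern Analysis* (8.6),
Hörmander, *ALPDO I*, Thm. 1.1.7 ff. use it implicitly when passing derivatives to limits):

* `norm_fderiv_le_of_norm_le_of_lipschitz` — **Landau's inequality on a ball**: if `‖F‖ ≤ M₀` on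
  `ball p r` and `‖DF(y) - DF(p)‖ ≤ M₂ ‖y - p‖` there, then `‖DF(p)‖ ≤ 2 M₀ / s + s M₂` for every
  `0 < s < r` (mean value theorem twice);
* `norm_iteratedFDeriv_succ_le_of_bounds` — the same between the orders `k`, `k + 1`, `k + 2`
  of a smooth function;
* `eventually_norm_iteratedFDeriv_lt` — along any filter: functions tending to `0` uniformly on
  a ball, with all derivatives (eventually) uniformly bounded there, have all derivatives tending
  to `0` uniformly on smaller balls;
* `uniformCauchySeqOn_iteratedFDeriv_of_uniformCauchySeqOn` — a sequence of smooth functions,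
  uniformly Cauchy on a ball with uniformly bounded derivatives of all orders, has uniformly
  Cauchy derivatives of all orders on smaller balls (the input of the tree's
  `Literature.Analysis.FunctionSpaces.contDiffOn_infty_of_uniformCauchySeqOn_iteratedFDeriv`);
* `eventually_norm_lt_of_equilipschitz` — equi-Lipschitz families converging pointwise converge
  uniformly on balls of a proper space;
* `tendsto_iteratedFDeriv_of_tendsto` — hence *pointwise convergence in a parameter plus uniform
  bounds on all derivatives gives convergence of every derivative*, and
  `continuousOn_iteratedFDeriv_param` — joint continuity of `(c, y) ↦ Dᵏ(K c)(y)` for a family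
  continuous in `c` pointwise with uniformly bounded derivatives. This is how measurability in
  time of slice derivatives, and the smoothness of limits of Picard iterates, are obtained without
  any estimate on differences of derivatives.

## Mathlib search

`Convex.norm_image_sub_le_of_norm_fderiv_le'` (mean value with a fixed linear map),
`hasFDerivAt_of_tendstoUniformlyOn` (one derivative to the limit, needs convergence of the
derivatives); no interpolation inequality between derivatives of different orders (searched
`Landau`, `Kolmogorov`, `interpol` in `Analysis/Calculus`: none).

## References

* E. Landau, *Einige Ungleichungen für zweimal differentiierbare Funktionen*, Proc. LMS 13 (1913).
* J. Dieudonné, *Foundations of Modern Analysis* (1960), (8.6.3)–(8.6.4).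
-/

noncomputable section

open Set Filter Function Metric Topology
open scoped ContDiff

namespace Literature.Analysis.Calculus

variable {P : Type*} [NormedAddCommGroup P] [NormedSpace ℝ P]
variable {G : Type*} [NormedAddCommGroup G] [NormedSpace ℝ G]

/-! ### Landau's inequality -/

/-- **Landau's inequality on a ball.** If `F` is differentiable on `ball p r`, `‖F y‖ ≤ M₀` there,
and `‖DF(y) - DF(p)‖ ≤ M₂ ‖y - p‖` there (`M₂ ≥ 0`), then for every `0 < s < r`,
`‖DF(p)‖ ≤ 2 M₀ / s + s M₂`: by the mean value theorem
`‖F(p + s x) - F(p) - s DF(p) x‖ ≤ M₂ s²` for `‖x‖ = 1`. [folklore] -/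
theorem norm_fderiv_le_of_norm_le_of_lipschitz {F : P → G} {p : P} {r M₀ M₂ : ℝ}
    (hF : ∀ y ∈ ball p r, DifferentiableAt ℝ F y) (h0 : ∀ y ∈ ball p r, ‖F y‖ ≤ M₀)
    (hM₂ : 0 ≤ M₂) (h2 : ∀ y ∈ ball p r, ‖fderiv ℝ F y - fderiv ℝ F p‖ ≤ M₂ * ‖y - p‖)
    {s : ℝ} (hs : 0 < s) (hsr : s < r) :
    ‖fderiv ℝ F p‖ ≤ 2 * M₀ / s + s * M₂ := by
  have hr : 0 < r := hs.trans hsr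
  have hp : p ∈ ball p r := mem_ball_self hr
  have hM₀ : 0 ≤ M₀ := (norm_nonneg _).trans (h0 p hp)
  have hsub : closedBall p s ⊆ ball p r := closedBall_subset_ball hsr
  refine ContinuousLinearMap.opNorm_le_of_unit_norm (by positivity) fun x hx => ?_
  set y : P := p + s • x with hy
  have hyp : y - p = s • x := by rw [hy]; abel
  have hdist : ‖y - p‖ = s := by rw [hyp, norm_smul, Real.norm_of_nonneg hs.le, hx, mul_one]
  have hymem : y ∈ closedBall p s := by rw [mem_closedBall, dist_eq_norm, hdist]
  -- mean value theorem with the fixed linear map `DF(p)` on `closedBall p s`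
  have hmvt : ‖F y - F p - fderiv ℝ F p (y - p)‖ ≤ M₂ * s * ‖y - p‖ := by
    refine (convex_closedBall p s).norm_image_sub_le_of_norm_fderiv_le'
      (fun z hz => hF z (hsub hz)) (fun z hz => ?_) (mem_closedBall_self hs.le) hymem
    calc ‖fderiv ℝ F z - fderiv ℝ F p‖ ≤ M₂ * ‖z - p‖ := h2 z (hsub hz)
      _ ≤ M₂ * s := by
          refine mul_le_mul_of_nonneg_left ?_ hM₂
          rwa [mem_closedBall, dist_eq_norm] at hz
  rw [hdist, hyp, map_smul] at hmvt
  have hFy : ‖F y‖ ≤ M₀ := h0 y (hsub hymem)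
  have hFp : ‖F p‖ ≤ M₀ := h0 p hp
  have hkey : s * ‖fderiv ℝ F p x‖ ≤ 2 * M₀ + M₂ * s * s := by
    have h1 : ‖s • fderiv ℝ F p x‖ ≤ ‖F y - F p‖ + ‖F y - F p - s • fderiv ℝ F p x‖ := by
      have := norm_sub_le (F y - F p) (F y - F p - s • fderiv ℝ F p x)
      rwa [sub_sub_cancel] at this
    rw [norm_smul, Real.norm_of_nonneg hs.le] at h1
    have h3 : ‖F y - F p‖ ≤ 2 * M₀ := (norm_sub_le _ _).trans (by linarith)
    linarith
  rw [div_add' _ _ _ hs.ne', le_div_iff₀ hs]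
  nlinarith

/-- `fderiv (Dᵏ f) = curryLeft ∘ Dᵏ⁺¹ f`, pointwise. [folklore] -/
theorem fderiv_iteratedFDeriv_apply_eq_curry (f : P → G) (k : ℕ) (y : P) :
    fderiv ℝ (iteratedFDeriv ℝ k f) y =
      continuousMultilinearCurryLeftEquiv ℝ (fun _ : Fin (k + 1) => P) G
        (iteratedFDeriv ℝ (k + 1) f y) := by
  rw [iteratedFDeriv_succ_eq_comp_left, comp_apply, LinearIsometryEquiv.apply_symm_apply]

/-- **Landau's inequality between consecutive orders.** For a smooth `f`, if `‖Dᵏ f‖ ≤ M₀` and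
`‖Dᵏ⁺² f‖ ≤ M₂` on `ball p r`, then `‖Dᵏ⁺¹ f (p)‖ ≤ 2 M₀ / s + s M₂` for every `0 < s < r`. [folklore] -/
theorem norm_iteratedFDeriv_succ_le_of_bounds {f : P → G} (hf : ContDiff ℝ ∞ f) {p : P}
    {r M₀ M₂ : ℝ} (hM₂ : 0 ≤ M₂) {k : ℕ} (h0 : ∀ y ∈ ball p r, ‖iteratedFDeriv ℝ k f y‖ ≤ M₀)
    (h2 : ∀ y ∈ ball p r, ‖iteratedFDeriv ℝ (k + 2) f y‖ ≤ M₂) {s : ℝ} (hs : 0 < s) (hsr : s < r) :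
    ‖iteratedFDeriv ℝ (k + 1) f p‖ ≤ 2 * M₀ / s + s * M₂ := by
  have hlt : ∀ m : ℕ, (m : ℕ∞ω) < ∞ := fun m => by
    exact_mod_cast WithTop.coe_lt_coe.2 (ENat.coe_lt_top m)
  rw [← norm_fderiv_iteratedFDeriv]
  refine norm_fderiv_le_of_norm_le_of_lipschitz (fun y _ => (hf.differentiable_iteratedFDeriv
    (hlt k) y)) h0 hM₂ (fun y hy => ?_) hs hsr
  -- `‖fderiv (Dᵏ f) y - fderiv (Dᵏ f) p‖ = ‖Dᵏ⁺¹ f y - Dᵏ⁺¹ f p‖ ≤ M₂ ‖y - p‖`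
  rw [fderiv_iteratedFDeriv_apply_eq_curry, fderiv_iteratedFDeriv_apply_eq_curry,
    ← LinearIsometryEquiv.map_sub, LinearIsometryEquiv.norm_map]
  have hr : 0 < r := hs.trans hsr
  refine (convex_ball p r).norm_image_sub_le_of_norm_fderiv_le
    (fun z _ => hf.differentiable_iteratedFDeriv (hlt (k + 1)) z) (fun z hz => ?_)
    (mem_ball_self hr) hy
  rw [norm_fderiv_iteratedFDeriv]
  exact h2 z hz

/-! ### Convergence of all derivatives from convergence of the functions -/

omit [NormedSpace ℝ P] in
/-- Balls of radius `R / 2 ^ (k+1)` around points of `ball p (R / 2 ^ (k+1))` stay inside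
`ball p (R / 2 ^ k)`. [folklore] -/
theorem ball_subset_ball_half {p y : P} {R : ℝ} {k : ℕ} (hy : y ∈ ball p (R / 2 ^ (k + 1))) :
    ball y (R / 2 ^ (k + 1)) ⊆ ball p (R / 2 ^ k) := by
  intro z hz
  rw [mem_ball] at hy hz ⊢
  have hR : R / 2 ^ k = R / 2 ^ (k + 1) + R / 2 ^ (k + 1) := by rw [pow_succ]; ring
  calc dist z p ≤ dist z y + dist y p := dist_triangle _ _ _
    _ < R / 2 ^ (k + 1) + R / 2 ^ (k + 1) := add_lt_add hz hy
    _ = R / 2 ^ k := hR.symm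

/-- **All derivatives tend to zero uniformly on smaller balls.** Along a filter `l`, let `g i` be
smooth functions tending to `0` uniformly on `ball p R`, whose derivatives of every order are,
eventually along `l`, bounded on `ball p R` uniformly in `i`. Then for every `k` the `k`-th
derivatives tend to `0` uniformly on `ball p (R / 2ᵏ)` (induction on `k` through Landau's
inequality: smallness of order `k` and boundedness of order `k + 2` give smallness of order
`k + 1`). [folklore] -/
theorem eventually_norm_iteratedFDeriv_lt {ι : Type*} {l : Filter ι} {g : ι → P → G}
    (hg : ∀ i, ContDiff ℝ ∞ (g i)) {p : P} {R : ℝ} (hR : 0 < R)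
    (hb : ∀ k : ℕ, ∃ M : ℝ, ∀ᶠ i in l, ∀ y ∈ ball p R, ‖iteratedFDeriv ℝ k (g i) y‖ ≤ M)
    (h0 : ∀ ε > 0, ∀ᶠ i in l, ∀ y ∈ ball p R, ‖g i y‖ < ε) (k : ℕ) :
    ∀ ε > 0, ∀ᶠ i in l, ∀ y ∈ ball p (R / 2 ^ k), ‖iteratedFDeriv ℝ k (g i) y‖ < ε := by
  induction k with
  | zero =>
    intro ε hε
    simp only [pow_zero, div_one, norm_iteratedFDeriv_zero]
    exact h0 ε hε
  | succ k ih =>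
    intro ε hε
    obtain ⟨M, hM⟩ := hb (k + 2)
    set M' : ℝ := max M 0 with hM'
    have hM'0 : 0 ≤ M' := le_max_right _ _
    set r : ℝ := R / 2 ^ (k + 1) with hr
    have hr0 : 0 < r := by positivity
    set s : ℝ := min (r / 2) (ε / (2 * (M' + 1))) with hs_def
    have hs0 : 0 < s := lt_min (by positivity) (by positivity)
    have hsr : s < r := (min_le_left _ _).trans_lt (by linarith)
    have hsM : s * M' < ε / 2 := by
      calc s * M' ≤ ε / (2 * (M' + 1)) * M' := mul_le_mul_of_nonneg_right (min_le_right _ _) hM'0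
        _ < ε / (2 * (M' + 1)) * (M' + 1) := by gcongr; exact lt_add_one _
        _ = ε / 2 := by field_simp
    set η : ℝ := ε * s / 4 with hη
    have hη0 : 0 < η := by positivity
    filter_upwards [ih η hη0, hM] with i hi hMi y hy
    have hsub : ball y r ⊆ ball p (R / 2 ^ k) := ball_subset_ball_half hy
    have hsub' : ball y r ⊆ ball p R := hsub.trans (ball_subset_ball
      (div_le_self hR.le (one_le_pow₀ (by norm_num))))
    have hL := norm_iteratedFDeriv_succ_le_of_bounds (hg i) (p := y) hM'0 (k := k)
      (fun z hz => (hi z (hsub hz)).le) (fun z hz => (hMi z (hsub' hz)).trans (le_max_left _ _))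
      hs0 hsr
    calc ‖iteratedFDeriv ℝ (k + 1) (g i) y‖ ≤ 2 * η / s + s * M' := hL
      _ = ε / 2 + s * M' := by rw [hη]; field_simp; ring
      _ < ε / 2 + ε / 2 := by linarith
      _ = ε := by ring

/-- **Uniformly Cauchy derivatives from uniformly Cauchy functions.** A sequence of smooth
functions which is uniformly Cauchy on `ball p R` and has derivatives of all orders bounded on
`ball p R` uniformly along the sequence has, for every `k`, uniformly Cauchy `k`-th derivatives on
`ball p (R / 2ᵏ)`. [folklore] -/
theorem uniformCauchySeqOn_iteratedFDeriv_of_uniformCauchySeqOn {F : ℕ → P → G}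
    (hF : ∀ j, ContDiff ℝ ∞ (F j)) {p : P} {R : ℝ} (hR : 0 < R)
    (hb : ∀ k : ℕ, ∃ M : ℝ, ∀ j, ∀ y ∈ ball p R, ‖iteratedFDeriv ℝ k (F j) y‖ ≤ M)
    (h0 : UniformCauchySeqOn F atTop (ball p R)) (k : ℕ) :
    UniformCauchySeqOn (fun j => iteratedFDeriv ℝ k (F j)) atTop (ball p (R / 2 ^ k)) := by
  have hlt : ∀ m : ℕ, (m : ℕ∞ω) < ∞ := fun m => by
    exact_mod_cast WithTop.coe_lt_coe.2 (ENat.coe_lt_top m)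
  -- the differences `F j - F j'` along `atTop` on `ℕ × ℕ`
  set g : ℕ × ℕ → P → G := fun q y => F q.1 y - F q.2 y with hg_def
  have hgs : ∀ q, ContDiff ℝ ∞ (g q) := fun q => (hF q.1).sub (hF q.2)
  have hgD : ∀ (m : ℕ) (q : ℕ × ℕ) (y : P), iteratedFDeriv ℝ m (g q) y =
      iteratedFDeriv ℝ m (F q.1) y - iteratedFDeriv ℝ m (F q.2) y := fun m q y =>
    iteratedFDeriv_sub_apply ((hF q.1).of_le (hlt m).le).contDiffAt
      ((hF q.2).of_le (hlt m).le).contDiffAt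
  have hgb : ∀ m : ℕ, ∃ M : ℝ, ∀ᶠ q in atTop, ∀ y ∈ ball p R, ‖iteratedFDeriv ℝ m (g q) y‖ ≤ M := by
    intro m
    obtain ⟨M, hM⟩ := hb m
    refine ⟨M + M, Eventually.of_forall fun q y hy => ?_⟩
    rw [hgD]
    exact (norm_sub_le _ _).trans (add_le_add (hM _ y hy) (hM _ y hy))
  have hg0 : ∀ ε > 0, ∀ᶠ q in atTop, ∀ y ∈ ball p R, ‖g q y‖ < ε := by
    intro ε hε
    obtain ⟨N, hN⟩ := Metric.uniformCauchySeqOn_iff.1 h0 ε hε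
    rw [eventually_atTop_prod_self']
    refine ⟨N, fun j hj j' hj' y hy => ?_⟩
    rw [hg_def]
    dsimp only
    rw [← dist_eq_norm]
    exact hN j hj j' hj' y hy
  have key := eventually_norm_iteratedFDeriv_lt hgs hR hgb hg0 k
  refine Metric.uniformCauchySeqOn_iff.2 fun ε hε => ?_
  obtain ⟨N, hN⟩ := eventually_atTop_prod_self'.1 (key ε hε)
  refine ⟨N, fun j hj j' hj' y hy => ?_⟩
  rw [dist_eq_norm, ← hgD k (j, j') y]
  exact hN j hj j' hj' y hy

/-! ### Pointwise convergence in a parameter plus bounds -/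

omit [NormedSpace ℝ P] [NormedSpace ℝ G] in
/-- **Equi-Lipschitz families converging pointwise converge uniformly on balls** of a proper
space (finite `ε`-nets). [folklore] -/
theorem eventually_norm_lt_of_equilipschitz [ProperSpace P] {ι : Type*} {l : Filter ι}
    {g : ι → P → G} {p : P} {R L : ℝ}
    (hL : ∀ᶠ i in l, ∀ y ∈ ball p R, ∀ y' ∈ ball p R, ‖g i y - g i y'‖ ≤ L * ‖y - y'‖)
    (h0 : ∀ y ∈ ball p R, Tendsto (fun i => g i y) l (𝓝 0)) :
    ∀ ε > 0, ∀ᶠ i in l, ∀ y ∈ ball p R, ‖g i y‖ < ε := by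
  intro ε hε
  set L' : ℝ := max L 0 with hL'
  have hL'0 : 0 ≤ L' := le_max_right _ _
  set δ : ℝ := ε / (2 * (L' + 1)) with hδ
  have hδ0 : 0 < δ := by positivity
  have hδL : L' * δ < ε / 2 := by
    calc L' * δ < (L' + 1) * δ := mul_lt_mul_of_pos_right (lt_add_one _) hδ0
      _ = ε / 2 := by rw [hδ]; field_simp
  -- a finite `δ`-net of the ball
  have htb : TotallyBounded (ball p R) :=
    (isCompact_closedBall p R).totallyBounded.subset ball_subset_closedBall
  obtain ⟨t, hts, htf, hcover⟩ := finite_approx_of_totallyBounded htb δ hδ0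
  have hnet : ∀ᶠ i in l, ∀ y₀ ∈ t, ‖g i y₀‖ < ε / 2 := by
    refine (htf.eventually_all).2 fun y₀ hy₀ => ?_
    have h := (h0 y₀ (hts hy₀)).eventually (Metric.ball_mem_nhds (0 : G) (half_pos hε))
    exact h.mono fun i hi => by simpa [dist_eq_norm] using hi
  filter_upwards [hL, hnet] with i hLi hni y hy
  obtain ⟨y₀, hy₀t, hyy₀⟩ : ∃ y₀ ∈ t, y ∈ ball y₀ δ := by
    simpa only [mem_iUnion, exists_prop] using hcover hy
  rw [mem_ball, dist_eq_norm] at hyy₀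
  calc ‖g i y‖ ≤ ‖g i y - g i y₀‖ + ‖g i y₀‖ := norm_le_norm_sub_add _ _
    _ ≤ L * ‖y - y₀‖ + ‖g i y₀‖ := add_le_add (hLi y hy y₀ (hts hy₀t)) le_rfl
    _ ≤ L' * ‖y - y₀‖ + ‖g i y₀‖ := by gcongr; exact le_max_left _ _
    _ < L' * δ + ε / 2 := add_lt_add_of_le_of_lt (mul_le_mul_of_nonneg_left hyy₀.le hL'0)
        (hni y₀ hy₀t)
    _ < ε / 2 + ε / 2 := by linarith
    _ = ε := by ring

/-- Smooth functions with first derivative bounded by `M₁` on a ball are `M₁`-Lipschitz there.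
[folklore] -/
theorem norm_sub_le_of_norm_iteratedFDeriv_one_le {f : P → G} (hf : ContDiff ℝ ∞ f) {p : P}
    {R M₁ : ℝ} (h1 : ∀ y ∈ ball p R, ‖iteratedFDeriv ℝ 1 f y‖ ≤ M₁) {y y' : P} (hy : y ∈ ball p R)
    (hy' : y' ∈ ball p R) : ‖f y - f y'‖ ≤ M₁ * ‖y - y'‖ := by
  have h1' : ∀ z ∈ ball p R, ‖fderiv ℝ f z‖ ≤ M₁ := fun z hz => by
    rw [← norm_iteratedFDeriv_one]; exact h1 z hz
  exact (convex_ball p R).norm_image_sub_le_of_norm_fderiv_le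
    (fun z _ => (hf.differentiable (by simp) z)) h1' hy' hy

/-- **Convergence of every derivative from pointwise convergence and uniform bounds.** Let `K c`
(`c` along a filter `l`) and `K₀` be smooth, with derivatives of all orders bounded on `ball p R`
uniformly (eventually along `l`, and for `K₀`), and `K c y → K₀ y` for every `y ∈ ball p R`. Then
`Dᵏ(K c)(p) → Dᵏ K₀ (p)` for every `k` (equi-Lipschitz bounds make the convergence uniform on the
ball, and Landau's inequality passes it to the derivatives). [folklore] -/
theorem tendsto_iteratedFDeriv_of_tendsto [ProperSpace P] {C : Type*} {l : Filter C} {K : C → P → G}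
    {K₀ : P → G} (hK : ∀ c, ContDiff ℝ ∞ (K c)) (hK₀ : ContDiff ℝ ∞ K₀) {p : P} {R : ℝ} (hR : 0 < R)
    (hb : ∀ k : ℕ, ∃ M : ℝ, (∀ᶠ c in l, ∀ y ∈ ball p R, ‖iteratedFDeriv ℝ k (K c) y‖ ≤ M) ∧
      ∀ y ∈ ball p R, ‖iteratedFDeriv ℝ k K₀ y‖ ≤ M)
    (h0 : ∀ y ∈ ball p R, Tendsto (fun c => K c y) l (𝓝 (K₀ y))) (k : ℕ) :
    Tendsto (fun c => iteratedFDeriv ℝ k (K c) p) l (𝓝 (iteratedFDeriv ℝ k K₀ p)) := by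
  have hlt : ∀ m : ℕ, (m : ℕ∞ω) < ∞ := fun m => by
    exact_mod_cast WithTop.coe_lt_coe.2 (ENat.coe_lt_top m)
  set g : C → P → G := fun c y => K c y - K₀ y with hg_def
  have hgs : ∀ c, ContDiff ℝ ∞ (g c) := fun c => (hK c).sub hK₀
  have hgD : ∀ (m : ℕ) (c : C) (y : P), iteratedFDeriv ℝ m (g c) y =
      iteratedFDeriv ℝ m (K c) y - iteratedFDeriv ℝ m K₀ y := fun m c y =>
    iteratedFDeriv_sub_apply ((hK c).of_le (hlt m).le).contDiffAt (hK₀.of_le (hlt m).le).contDiffAt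
  have hgb : ∀ m : ℕ, ∃ M : ℝ, ∀ᶠ c in l, ∀ y ∈ ball p R, ‖iteratedFDeriv ℝ m (g c) y‖ ≤ M := by
    intro m
    obtain ⟨M, hM, hM₀⟩ := hb m
    refine ⟨M + M, hM.mono fun c hc y hy => ?_⟩
    rw [hgD]
    exact (norm_sub_le _ _).trans (add_le_add (hc y hy) (hM₀ y hy))
  -- level zero: equi-Lipschitz + pointwise convergence
  have hg0 : ∀ ε > 0, ∀ᶠ c in l, ∀ y ∈ ball p R, ‖g c y‖ < ε := by
    obtain ⟨M₁, hM₁, hM₁₀⟩ := hb 1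
    refine eventually_norm_lt_of_equilipschitz (L := M₁ + M₁) (hM₁.mono fun c hc y hy y' hy' => ?_)
      fun y hy => ?_
    · have e : g c y - g c y' = (K c y - K c y') - (K₀ y - K₀ y') := by
        simp only [hg_def]; abel
      rw [e, add_mul]
      exact (norm_sub_le _ _).trans (add_le_add (norm_sub_le_of_norm_iteratedFDeriv_one_le (hK c)
        hc hy hy') (norm_sub_le_of_norm_iteratedFDeriv_one_le hK₀ hM₁₀ hy hy'))
    · have := (h0 y hy).sub_const (K₀ y)
      rwa [sub_self] at this
  have key := eventually_norm_iteratedFDeriv_lt hgs hR hgb hg0 k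
  refine Metric.tendsto_nhds.2 fun ε hε => (key ε hε).mono fun c hc => ?_
  have hp : p ∈ ball p (R / 2 ^ k) := mem_ball_self (by positivity)
  rw [dist_eq_norm, ← hgD k c p]
  exact hc p hp

omit [NormedSpace ℝ P] [NormedSpace ℝ G] in
/-- **Joint continuity from continuity in the parameter and equi-Lipschitz bounds.** If
`c ↦ K c y` is continuous within `S` at every point of `S` for every `y`, and the `K c`, `c ∈ S`,
are `L`-Lipschitz, then `(c, y) ↦ K c y` is continuous on `S × P`. [folklore] -/
theorem continuousOn_uncurry_of_lipschitz {C : Type*} [TopologicalSpace C] {K : C → P → G}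
    {S : Set C} {L : ℝ} (hc : ∀ c₀ ∈ S, ∀ y, ContinuousWithinAt (fun c => K c y) S c₀)
    (hL : ∀ c ∈ S, ∀ y y', ‖K c y - K c y'‖ ≤ L * ‖y - y'‖) :
    ContinuousOn (fun q : C × P => K q.1 q.2) (S ×ˢ univ) := by
  rintro ⟨c₀, y₀⟩ ⟨hc₀, -⟩
  set L' : ℝ := max L 0 with hL'
  have hL'0 : 0 ≤ L' := le_max_right _ _
  refine Metric.tendsto_nhds.2 fun ε hε => ?_
  set δ : ℝ := ε / (2 * (L' + 1)) with hδ
  have hδ0 : 0 < δ := by positivity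
  have hδL : L' * δ < ε / 2 := by
    calc L' * δ < (L' + 1) * δ := mul_lt_mul_of_pos_right (lt_add_one _) hδ0
      _ = ε / 2 := by rw [hδ]; field_simp
  have h1 : ∀ᶠ c in 𝓝[S] c₀, dist (K c y₀) (K c₀ y₀) < ε / 2 :=
    Metric.tendsto_nhds.1 (hc c₀ hc₀ y₀) _ (half_pos hε)
  have h1' : ∀ᶠ c in 𝓝[S] c₀, c ∈ S := self_mem_nhdsWithin
  have h2 : ∀ᶠ y in 𝓝[univ] y₀, dist y y₀ < δ := by
    rw [nhdsWithin_univ]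
    exact Metric.ball_mem_nhds y₀ hδ0
  have h := (h1.and h1').prod_mk h2
  rw [← nhdsWithin_prod_eq] at h
  refine h.mono ?_
  rintro ⟨c, y⟩ ⟨⟨hc1, hcS⟩, hy⟩
  dsimp only at hc1 hcS hy ⊢
  calc dist (K c y) (K c₀ y₀) ≤ dist (K c y) (K c y₀) + dist (K c y₀) (K c₀ y₀) := dist_triangle _ _ _
    _ < L' * δ + ε / 2 := by
        refine add_lt_add_of_le_of_lt ?_ hc1
        rw [dist_eq_norm]
        calc ‖K c y - K c y₀‖ ≤ L * ‖y - y₀‖ := hL c hcS y y₀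
          _ ≤ L' * ‖y - y₀‖ := by gcongr; exact le_max_left _ _
          _ ≤ L' * δ := by
              refine mul_le_mul_of_nonneg_left ?_ hL'0
              rw [← dist_eq_norm]; exact hy.le
    _ < ε / 2 + ε / 2 := by linarith
    _ = ε := by ring

/-- Smooth functions with `(k+1)`-st derivative bounded by `M` have `M`-Lipschitz `k`-th
derivative. [folklore] -/
theorem norm_iteratedFDeriv_sub_le_of_bound {f : P → G} (hf : ContDiff ℝ ∞ f) {k : ℕ} {M : ℝ}
    (hM : ∀ y, ‖iteratedFDeriv ℝ (k + 1) f y‖ ≤ M) (y y' : P) :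
    ‖iteratedFDeriv ℝ k f y - iteratedFDeriv ℝ k f y'‖ ≤ M * ‖y - y'‖ := by
  have hlt : (k : ℕ∞ω) < ∞ := by exact_mod_cast WithTop.coe_lt_coe.2 (ENat.coe_lt_top k)
  refine convex_univ.norm_image_sub_le_of_norm_fderiv_le
    (fun z _ => hf.differentiable_iteratedFDeriv hlt z) (fun z _ => ?_) (mem_univ y') (mem_univ y)
  rw [norm_fderiv_iteratedFDeriv]
  exact hM z

/-- **Joint continuity of all derivatives of a family continuous in the parameter.** Let `K c`
be smooth for every `c`, with derivatives of all orders bounded uniformly in `c ∈ S`, and let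
`c ↦ K c y` be continuous within `S` on `S` for every `y`. Then for every `k`,
`(c, y) ↦ Dᵏ(K c)(y)` is continuous on `S × P` (`P` proper, e.g. finite dimensional). In
particular `c ↦ Dᵏ(K c)(y)` is measurable on `S` for every `y`. [folklore] -/
theorem continuousOn_iteratedFDeriv_param [ProperSpace P] {C : Type*} [TopologicalSpace C]
    {K : C → P → G} {S : Set C} (hK : ∀ c, ContDiff ℝ ∞ (K c))
    (hb : ∀ k : ℕ, ∃ M : ℝ, ∀ c ∈ S, ∀ y, ‖iteratedFDeriv ℝ k (K c) y‖ ≤ M)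
    (hc : ∀ c₀ ∈ S, ∀ y, ContinuousWithinAt (fun c => K c y) S c₀) (k : ℕ) :
    ContinuousOn (fun q : C × P => iteratedFDeriv ℝ k (K q.1) q.2) (S ×ˢ univ) := by
  obtain ⟨M, hM⟩ := hb (k + 1)
  refine continuousOn_uncurry_of_lipschitz (K := fun c => iteratedFDeriv ℝ k (K c)) (L := M)
    (fun c₀ hc₀ y => ?_) fun c hcS y y' => norm_iteratedFDeriv_sub_le_of_bound (hK c) (hM c hcS) y y'
  refine tendsto_iteratedFDeriv_of_tendsto (l := 𝓝[S] c₀) hK (hK c₀) (R := 1) one_pos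
    (fun m => ?_) (fun z _ => hc c₀ hc₀ z) k
  obtain ⟨M', hM'⟩ := hb m
  exact ⟨M', mem_of_superset self_mem_nhdsWithin fun c hcS z _ => hM' c hcS z,
    fun z _ => hM' c₀ hc₀ z⟩

/-- Pointwise form: under the hypotheses of `continuousOn_iteratedFDeriv_param`,
`c ↦ Dᵏ(K c)(y)` is continuous within `S` at every `c₀ ∈ S`. [folklore] -/
theorem continuousWithinAt_iteratedFDeriv_param [ProperSpace P] {C : Type*} [TopologicalSpace C]
    {K : C → P → G} {S : Set C} (hK : ∀ c, ContDiff ℝ ∞ (K c))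
    (hb : ∀ k : ℕ, ∃ M : ℝ, ∀ c ∈ S, ∀ y, ‖iteratedFDeriv ℝ k (K c) y‖ ≤ M)
    (hc : ∀ c₀ ∈ S, ∀ y, ContinuousWithinAt (fun c => K c y) S c₀) (k : ℕ) {c₀ : C}
    (hc₀ : c₀ ∈ S) (y : P) :
    ContinuousWithinAt (fun c => iteratedFDeriv ℝ k (K c) y) S c₀ := by
  have h := (continuousOn_iteratedFDeriv_param hK hb hc k) (c₀, y) ⟨hc₀, mem_univ _⟩
  have h2 : ContinuousWithinAt (fun c : C => ((c, y) : C × P)) S c₀ :=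
    (continuous_id.prodMk continuous_const).continuousWithinAt
  exact ContinuousWithinAt.comp (f := fun c : C => ((c, y) : C × P)) (x := c₀) h h2
    fun c hcS => ⟨hcS, mem_univ _⟩

end Literature.Analysis.Calculus

end
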